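import Mathlib
import HarnessLib
import Summits.NavierStokesRegularity.NavierStokesRegularity.Theorems.PoloidalWindowDoorLrcModEntireCurvedTimeWebAt

/-!
# Route `PoloidalWindowDoor`, item `LrcModEntire` (stmt-NavierStokesRegularity-20428), cell (Q4-curved) of the (TH) column, v16 child «VERTICAL» —
# THE V-ENTRANCE: what a vertical critical sheet at the hot time gives on the WHOLE cylinder `Γ × ℝ`

Cell ns-regularity-ideate, helper seat ns-k2-port-2 g9 under the LEAD of item 20428 (ns-poloidal-K2-p3 g18, assignment P1 2026-08-30T02:05:23Z);
`--supports stmt-NavierStokesRegularity-20428 --as helper`.  PACKAGE CURRENCY: the hypotheses are class data, the horizontal `C^∞` unit-speed branch `Γ`, the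
`∀ q`-clause of K2-p2 g18's ★★ `…CurvedTimeWebAt.curved_time_web_package` (B-TWP0c: the space–time web function `n₀` in `Γ`'s Fermi frame with maximiser,
criticality, `κt > 0`, `μ < 1`, ridge law, slice law, Fermi Huygens family) VERBATIM, and the v16 literal (V0) «vertical critical sheet at the hot time» in the
form the V-child's closer holds after `subst` (`∃ δᵥ > 0, ∀ s z, |z| < δᵥ → σ·U(−1)(Γ s + z·e₂)₂ = R 0 z`).

★★ `vertical_entrance` — conclusions, for the slice `U(−1)`:
* (E0) `n₀(0,s,z) = 0` for all `s` and `|z| < min δᵥ δ′` (uniqueness of the maximiser: the centre carries the ridge value);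
* (E1) `fderiv (U₂(−1,·)) (Γ s + z·e₂) w = 0` for EVERY `s`, EVERY REAL `z` and every horizontal `w` — the whole cylinder `Γ × ℝ` is horizontally critical
  (criticality at the web points = centre points for small `|z|`, then analytic continuation in `z`: the slice is real-analytic on `ℝ³`);
* (E2) `U₂(−1)(Γ s + z·e₂) = U₂(−1)(Γ 0 + z·e₂)` for every `s` and every real `z` (values `s`-free on the cylinder);
* (E3) in the (TH) slab `|z| < ρ`: `∂_z U_b(−1)(Γ s + z·e₂) = 0` for `b ≠ 2` (slope law × (E1)) and `curl U(−1) (Γ s + z·e₂) = 0` (poloidal + (E1) + slope law);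
* (E4) for `|z| < min δᵥ δ′` and every `s`: the ridge law AT THE CENTRE in frame and in coordinate form
  (`D²(σU₂)[Γ′,Γ′] + D²(σU₂)[JΓ′,JΓ′] = σ·Δₕ U₂ = −κt(0,z)`), the slice law at the centre (`D²(σU₂)[e₂,e₂] = μ(−1,z)·κt(0,z)`), and the VERTICAL HUYGENS
  identity `R_zz(0,z) = μ(−1,z)·κt(0,z)` (the Fermi Huygens family with `∂_z n₀ = ∂_s n₀ = 0` on the plane `τ = 0`).

WHAT THIS IS NOT: not a claim about Navier–Stokes regularity; closes nothing (it is the entrance of the RESEARCH slot `stub_Q4curvedAperiodicVertical` of v16);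
items 20428 / 19708 / 27893 OPEN (bears_on LADDER-NS N0).
-/

noncomputable section

set_option linter.dupNamespace false
set_option linter.style.longLine false

namespace Summit.NavierStokesRegularity.NavierStokesRegularity.Theorems.PoloidalWindowDoorLrcModEntireQ4CurvedVerticalEntrance

open Set Function Filter Topology Metric
open scoped RealInnerProductSpace InnerProductSpace Laplacian ContDiff
open Literature.Analysis Literature.Analysis.FluidPDE Literature.Analysis.UnboundedOperators
open Summit.NavierStokesRegularity.NavierStokesRegularity.Theorems
open Summit.NavierStokesRegularity.NavierStokesRegularity.Theorems.LocalSineTubeDoorProfileAlignedWindowRigidityAncient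
open Summit.NavierStokesRegularity.NavierStokesRegularity.Theorems.PoloidalWindowDoorLrcModEntireSheetFlattenTools
open Summit.NavierStokesRegularity.NavierStokesRegularity.Theorems.PoloidalWindowDoorLrcModEntireRidgeGlobalBranchODE
open Summit.NavierStokesRegularity.NavierStokesRegularity.Theorems.PoloidalWindowDoorLrcModEntireRidgeGlobalBranchFrame
open Summit.NavierStokesRegularity.NavierStokesRegularity.Theorems.PoloidalWindowDoorLrcModEntirePlanarCurveRigidity
open Summit.NavierStokesRegularity.NavierStokesRegularity.Theorems.PoloidalWindowDoorLrcModEntireRidgeClassConstants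
open Summit.NavierStokesRegularity.NavierStokesRegularity.Theorems.PoloidalWindowDoorLrcModEntireQ4TimeWebFunction

variable {C : ℝ} {U : ℝ → EuclideanSpace ℝ (Fin 3) → EuclideanSpace ℝ (Fin 3)}

/-- ★★ **THE V-ENTRANCE.**  See the module docstring: class data + the branch + the `∀ q`-clause of `curved_time_web_package` verbatim + (V0) ⊢ (E0)–(E4). -/
theorem vertical_entrance
    (hrate : HasTypeITimeDecay C U) (hcont : ContinuousOn (uncurry U) (Iio (0 : ℝ) ×ˢ univ))
    (hmild : ∀ s t : ℝ, s < t → t < 0 → ∀ x, U t x = heatExtension (U s) (t - s) x - oseenDuhamel 1 s U U t x)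
    (hdiv : ∀ t < 0, VectorCalculus.IsDivFree (U t))
    (hpol : ∀ s < 0, ∀ y, ⟪curl (U s) y, EuclideanSpace.single 2 1⟫_ℝ = 0)
    {σ ρ r δ' : ℝ} {μ R κt : ℝ → ℝ → ℝ} {n₀ : ℝ × ℝ × ℝ → ℝ} {k : ℝ → ℝ} {Γ : ℝ → EuclideanSpace ℝ (Fin 3)}
    (hρ : 0 < ρ)
    (hslabU : ∀ t : ℝ, |t + 1| < ρ → ∀ x : EuclideanSpace ℝ (Fin 3), |x 2| < ρ → ∀ b : Fin 3, b ≠ 2 →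
      fderiv ℝ (U t) x (EuclideanSpace.single 2 1) b = μ t (x 2) * fderiv ℝ (U t) x (EuclideanSpace.single b 1) 2)
    (hσ : σ = 1 ∨ σ = -1) (hΓ : ContDiff ℝ ∞ Γ) (hΓ2 : ∀ s, Γ s 2 = 0) (hΓunit : ∀ s, ‖deriv Γ s‖ = 1) (hr : 0 < r) (hδ' : 0 < δ')
    (hq : ∀ q : ℝ × ℝ × ℝ, |q.1| < δ' → |q.2.2| < δ' →
        n₀ q ∈ Ioo (-r) r ∧
        σ * U (-1 + q.1) (Γ q.2.1 + n₀ q • rotJ (deriv Γ q.2.1) + q.2.2 • e2) 2 = R q.1 q.2.2 ∧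
        (∀ n ∈ Icc (-r) r, n ≠ n₀ q → σ * U (-1 + q.1) (Γ q.2.1 + n • rotJ (deriv Γ q.2.1) + q.2.2 • e2) 2 < R q.1 q.2.2) ∧
        (∀ w : EuclideanSpace ℝ (Fin 3), w 2 = 0 → fderiv ℝ (fun y => U (-1 + q.1) y 2) (Γ q.2.1 + n₀ q • rotJ (deriv Γ q.2.1) + q.2.2 • e2) w = 0) ∧
        (∀ m : ℕ∞, ContDiffAt ℝ m n₀ q) ∧
        0 < κt q.1 q.2.2 ∧ μ (-1 + q.1) q.2.2 < 1 ∧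
        fderiv ℝ (fderiv ℝ (fun y => σ * U (-1 + q.1) y 2)) (Γ q.2.1 + n₀ q • rotJ (deriv Γ q.2.1) + q.2.2 • e2) (deriv Γ q.2.1) (deriv Γ q.2.1) +
            fderiv ℝ (fderiv ℝ (fun y => σ * U (-1 + q.1) y 2)) (Γ q.2.1 + n₀ q • rotJ (deriv Γ q.2.1) + q.2.2 • e2)
              (rotJ (deriv Γ q.2.1)) (rotJ (deriv Γ q.2.1)) = -κt q.1 q.2.2 ∧
        fderiv ℝ (fderiv ℝ (fun y => σ * U (-1 + q.1) y 2)) (Γ q.2.1 + n₀ q • rotJ (deriv Γ q.2.1) + q.2.2 • e2) e2 e2 =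
          -μ (-1 + q.1) q.2.2 *
            (fderiv ℝ (fderiv ℝ (fun y => σ * U (-1 + q.1) y 2)) (Γ q.2.1 + n₀ q • rotJ (deriv Γ q.2.1) + q.2.2 • e2) (deriv Γ q.2.1) (deriv Γ q.2.1) +
              fderiv ℝ (fderiv ℝ (fun y => σ * U (-1 + q.1) y 2)) (Γ q.2.1 + n₀ q • rotJ (deriv Γ q.2.1) + q.2.2 • e2)
                (rotJ (deriv Γ q.2.1)) (rotJ (deriv Γ q.2.1))) ∧
        κt q.1 q.2.2 * (1 - k q.2.1 * n₀ q) ^ 2 * (fderiv ℝ n₀ q ((0 : ℝ), (0 : ℝ), (1 : ℝ))) ^ 2 =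
          (deriv (deriv (R q.1)) q.2.2 - μ (-1 + q.1) q.2.2 * κt q.1 q.2.2) *
            ((1 - k q.2.1 * n₀ q) ^ 2 + (fderiv ℝ n₀ q ((0 : ℝ), (1 : ℝ), (0 : ℝ))) ^ 2))
    (hV0 : ∃ δᵥ : ℝ, 0 < δᵥ ∧ ∀ s z : ℝ, |z| < δᵥ → σ * U (-1) (Γ s + z • EuclideanSpace.single 2 (1 : ℝ)) 2 = R 0 z) :
    ∃ δ₁ : ℝ, 0 < δ₁ ∧ δ₁ ≤ δ' ∧
      -- (E0) the web IS the centre line for small heights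
      (∀ s z : ℝ, |z| < δ₁ → n₀ ((0 : ℝ), s, z) = 0) ∧
      -- (E1) the whole cylinder `Γ × ℝ` is horizontally critical
      (∀ s z : ℝ, ∀ w : EuclideanSpace ℝ (Fin 3), w 2 = 0 → fderiv ℝ (fun y => U (-1) y 2) (Γ s + z • e2) w = 0) ∧
      -- (E2) the vertical velocity is `s`-free on the cylinder
      (∀ s z : ℝ, U (-1) (Γ s + z • e2) 2 = U (-1) (Γ 0 + z • e2) 2) ∧
      -- (E3) in the (TH) slab: the horizontal velocity is `z`-free on the cylinder and the vorticity vanishes there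
      (∀ s z : ℝ, |z| < ρ → ∀ b : Fin 3, b ≠ 2 → fderiv ℝ (U (-1)) (Γ s + z • e2) (EuclideanSpace.single 2 1) b = 0) ∧
      (∀ s z : ℝ, |z| < ρ → curl (U (-1)) (Γ s + z • e2) = 0) ∧
      -- (E4) at the centre, for small heights: ridge law (frame and coordinate form), slice law, vertical Huygens
      (∀ s z : ℝ, |z| < δ₁ →
        fderiv ℝ (fderiv ℝ (fun y => σ * U (-1) y 2)) (Γ s + z • e2) (deriv Γ s) (deriv Γ s) +
            fderiv ℝ (fderiv ℝ (fun y => σ * U (-1) y 2)) (Γ s + z • e2) (rotJ (deriv Γ s)) (rotJ (deriv Γ s)) = -κt 0 z ∧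
        σ * (fderiv ℝ (fun w => fderiv ℝ (fun y => U (-1) y 2) w (EuclideanSpace.single 0 (1 : ℝ))) (Γ s + z • e2) (EuclideanSpace.single 0 (1 : ℝ)) +
            fderiv ℝ (fun w => fderiv ℝ (fun y => U (-1) y 2) w (EuclideanSpace.single 1 (1 : ℝ))) (Γ s + z • e2) (EuclideanSpace.single 1 (1 : ℝ))) =
          -κt 0 z ∧
        fderiv ℝ (fderiv ℝ (fun y => σ * U (-1) y 2)) (Γ s + z • e2) e2 e2 = μ (-1) z * κt 0 z) ∧
      (∀ z : ℝ, |z| < δ₁ → deriv (deriv (R 0)) z = μ (-1) z * κt 0 z) := by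
  obtain ⟨δᵥ, hδᵥ, hV⟩ := hV0
  have hm1 : (-1 : ℝ) < 0 := by norm_num
  have hσ0 : σ ≠ 0 := by rcases hσ with h | h <;> rw [h] <;> norm_num
  -- the slice and its vertical component are real-analytic on `ℝ³`
  have hUan : AnalyticOnNhd ℝ (U (-1)) univ := analyticOnNhd_slice hcont (bdd_of_hasTypeITimeDecay hrate) hmild hm1
  have hUd : Differentiable ℝ (U (-1)) := fun x => (hUan x (mem_univ _)).differentiableAt
  have hθan : AnalyticOnNhd ℝ (fun y => U (-1) y 2) univ := fun x _ =>
    ((EuclideanSpace.proj (𝕜 := ℝ) (2 : Fin 3)).analyticAt _).comp (hUan x (mem_univ _))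
  have hθd : Differentiable ℝ (fun y => U (-1) y 2) := fun x => (hθan x (mem_univ _)).differentiableAt
  have hcoord : ∀ x w : EuclideanSpace ℝ (Fin 3), fderiv ℝ (fun y => U (-1) y 2) x w = fderiv ℝ (U (-1)) x w 2 := by
    intro x w
    have hc := ((EuclideanSpace.proj (𝕜 := ℝ) (2 : Fin 3)).hasFDerivAt.comp x (hUd x).hasFDerivAt).fderiv
    rw [show (fun y => U (-1) y 2) = (EuclideanSpace.proj (𝕜 := ℝ) (2 : Fin 3)) ∘ U (-1) from rfl, hc]
    rfl
  have hΓc2 : ContDiff ℝ 2 Γ := hΓ.of_le (by norm_cast)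
  have hT2 : ∀ s, deriv Γ s 2 = 0 := fun s => (deriv_horizontal hΓc2 hΓ2 s).1
  have hTunit : ∀ s, deriv Γ s 0 ^ 2 + deriv Γ s 1 ^ 2 = 1 := fun s => sq_add_sq_of_horizontal_unit (hT2 s) (hΓunit s)
  have he2 : (EuclideanSpace.single 2 (1 : ℝ) : EuclideanSpace ℝ (Fin 3)) = e2 := rfl
  have hx2 : ∀ s z : ℝ, (Γ s + z • e2) 2 = z := fun s z => by simp [hΓ2 s, e2]
  -- the window
  set δ₁ : ℝ := min δᵥ δ' with hδ₁
  have hδ₁pos : 0 < δ₁ := lt_min hδᵥ hδ'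
  have hδ₁v : ∀ z : ℝ, |z| < δ₁ → |z| < δᵥ := fun z hz => lt_of_lt_of_le hz (min_le_left _ _)
  have hδ₁' : ∀ z : ℝ, |z| < δ₁ → |z| < δ' := fun z hz => lt_of_lt_of_le hz (min_le_right _ _)
  have h0δ' : |(0 : ℝ)| < δ' := by simpa using hδ'
  -- the package at `τ = 0`
  have hP : ∀ s z : ℝ, |z| < δ₁ →
      n₀ ((0 : ℝ), s, z) ∈ Ioo (-r) r ∧
      (∀ n ∈ Icc (-r) r, n ≠ n₀ ((0 : ℝ), s, z) → σ * U (-1) (Γ s + n • rotJ (deriv Γ s) + z • e2) 2 < R 0 z) ∧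
      (∀ w : EuclideanSpace ℝ (Fin 3), w 2 = 0 → fderiv ℝ (fun y => U (-1) y 2) (Γ s + n₀ ((0 : ℝ), s, z) • rotJ (deriv Γ s) + z • e2) w = 0) ∧
      (∀ m : ℕ∞, ContDiffAt ℝ m n₀ ((0 : ℝ), s, z)) ∧
      fderiv ℝ (fderiv ℝ (fun y => σ * U (-1) y 2)) (Γ s + n₀ ((0 : ℝ), s, z) • rotJ (deriv Γ s) + z • e2) (deriv Γ s) (deriv Γ s) +
          fderiv ℝ (fderiv ℝ (fun y => σ * U (-1) y 2)) (Γ s + n₀ ((0 : ℝ), s, z) • rotJ (deriv Γ s) + z • e2) (rotJ (deriv Γ s)) (rotJ (deriv Γ s)) =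
        -κt 0 z ∧
      fderiv ℝ (fderiv ℝ (fun y => σ * U (-1) y 2)) (Γ s + n₀ ((0 : ℝ), s, z) • rotJ (deriv Γ s) + z • e2) e2 e2 =
        -μ (-1) z *
          (fderiv ℝ (fderiv ℝ (fun y => σ * U (-1) y 2)) (Γ s + n₀ ((0 : ℝ), s, z) • rotJ (deriv Γ s) + z • e2) (deriv Γ s) (deriv Γ s) +
            fderiv ℝ (fderiv ℝ (fun y => σ * U (-1) y 2)) (Γ s + n₀ ((0 : ℝ), s, z) • rotJ (deriv Γ s) + z • e2) (rotJ (deriv Γ s)) (rotJ (deriv Γ s))) ∧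
      κt 0 z * (1 - k s * n₀ ((0 : ℝ), s, z)) ^ 2 * (fderiv ℝ n₀ ((0 : ℝ), s, z) ((0 : ℝ), (0 : ℝ), (1 : ℝ))) ^ 2 =
        (deriv (deriv (R 0)) z - μ (-1) z * κt 0 z) *
          ((1 - k s * n₀ ((0 : ℝ), s, z)) ^ 2 + (fderiv ℝ n₀ ((0 : ℝ), s, z) ((0 : ℝ), (1 : ℝ), (0 : ℝ))) ^ 2) := by
    intro s z hz
    obtain ⟨h1, -, h3, h4, h5, -, -, h8, h9, h10⟩ := hq ((0 : ℝ), s, z) h0δ' (hδ₁' z hz)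
    simp only [add_zero] at h1 h3 h4 h5 h8 h9 h10
    exact ⟨h1, h3, h4, h5, h8, h9, h10⟩
  /- (E0): the centre carries the ridge value, so it IS the (unique) maximiser -/
  have hE0 : ∀ s z : ℝ, |z| < δ₁ → n₀ ((0 : ℝ), s, z) = 0 := by
    intro s z hz
    by_contra hne
    have h0I : (0 : ℝ) ∈ Icc (-r) r := ⟨by linarith, hr.le⟩
    have hlt := (hP s z hz).2.1 0 h0I (Ne.symm hne)
    rw [zero_smul, add_zero, ← he2, hV s z (hδ₁v z hz)] at hlt
    exact lt_irrefl _ hlt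
  /- (E1): criticality at the centre for small heights, then analytic continuation along the vertical line -/
  have hE1loc : ∀ s z : ℝ, |z| < δ₁ → ∀ w : EuclideanSpace ℝ (Fin 3), w 2 = 0 → fderiv ℝ (fun y => U (-1) y 2) (Γ s + z • e2) w = 0 := by
    intro s z hz w hw
    have h := (hP s z hz).2.2.1 w hw
    rwa [hE0 s z hz, zero_smul, add_zero] at h
  have hE1 : ∀ s z : ℝ, ∀ w : EuclideanSpace ℝ (Fin 3), w 2 = 0 → fderiv ℝ (fun y => U (-1) y 2) (Γ s + z • e2) w = 0 := by
    intro s z w hw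
    have hDan : AnalyticOnNhd ℝ (fderiv ℝ (fun y => U (-1) y 2)) univ := hθan.fderiv
    have hg : AnalyticOnNhd ℝ (fun z' : ℝ => fderiv ℝ (fun y => U (-1) y 2) (Γ s + z' • e2) w) univ := by
      intro z' _
      have hline : AnalyticAt ℝ (fun z'' : ℝ => Γ s + z'' • e2) z' := analyticAt_const.add (analyticAt_id.smul analyticAt_const)
      have hc : AnalyticAt ℝ (fun z'' : ℝ => fderiv ℝ (fun y => U (-1) y 2) (Γ s + z'' • e2)) z' := (hDan _ (mem_univ _)).comp hline
      have hc2 : AnalyticAt ℝ (fun z'' : ℝ => (ContinuousLinearMap.apply ℝ ℝ w) (fderiv ℝ (fun y => U (-1) y 2) (Γ s + z'' • e2))) z' :=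
        ((ContinuousLinearMap.apply ℝ ℝ w).analyticAt _).comp hc
      simpa only [ContinuousLinearMap.apply_apply] using hc2
    have hev : (fun z' : ℝ => fderiv ℝ (fun y => U (-1) y 2) (Γ s + z' • e2) w) =ᶠ[𝓝 (0 : ℝ)] 0 := by
      have hmem : Ioo (-δ₁) δ₁ ∈ 𝓝 (0 : ℝ) := isOpen_Ioo.mem_nhds ⟨by linarith, hδ₁pos⟩
      filter_upwards [hmem] with z' hz'
      exact hE1loc s z' (abs_lt.2 ⟨hz'.1, hz'.2⟩) w hw
    have hzero := hg.eqOn_zero_of_preconnected_of_eventuallyEq_zero isPreconnected_univ (mem_univ (0 : ℝ)) hev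
    exact hzero (mem_univ z)
  /- (E2): `s ↦ U₂(−1)(Γ s + z·e₂)` has derivative `∂_{Γ′}U₂ = 0` -/
  have hE2 : ∀ s z : ℝ, U (-1) (Γ s + z • e2) 2 = U (-1) (Γ 0 + z • e2) 2 := by
    intro s z
    have hD : ∀ s', HasDerivAt (fun s'' : ℝ => U (-1) (Γ s'' + z • e2) 2) 0 s' := by
      intro s'
      have hl : HasDerivAt (fun s'' : ℝ => Γ s'' + z • e2) (deriv Γ s') s' := ((hΓ.differentiable (by simp)) s').hasDerivAt.add_const (z • e2)
      have hc : HasDerivAt (fun s'' : ℝ => U (-1) (Γ s'' + z • e2) 2) (fderiv ℝ (fun y => U (-1) y 2) (Γ s' + z • e2) (deriv Γ s')) s' :=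
        (hθd _).hasFDerivAt.comp_hasDerivAt s' hl
      rwa [hE1 s' z (deriv Γ s') (hT2 s')] at hc
    exact is_const_of_deriv_eq_zero (fun s' => (hD s').differentiableAt) (fun s' => (hD s').deriv) s 0
  /- (E3): slope law × (E1), and the vorticity -/
  have hm1ρ : |(-1 : ℝ) + 1| < ρ := by norm_num; exact hρ
  have hE3 : ∀ s z : ℝ, |z| < ρ → ∀ b : Fin 3, b ≠ 2 → fderiv ℝ (U (-1)) (Γ s + z • e2) (EuclideanSpace.single 2 1) b = 0 := by
    intro s z hz b hb
    have h := hslabU (-1) hm1ρ (Γ s + z • e2) (by rw [hx2]; exact hz) b hb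
    have hw : (EuclideanSpace.single b (1 : ℝ) : EuclideanSpace ℝ (Fin 3)) 2 = 0 := by simp [Ne.symm hb]
    rw [← hcoord, hE1 s z _ hw, mul_zero] at h
    exact h
  have hcurl : ∀ s z : ℝ, |z| < ρ → curl (U (-1)) (Γ s + z • e2) = 0 := by
    intro s z hz
    have hD02 : fderiv ℝ (U (-1)) (Γ s + z • e2) (EuclideanSpace.single 0 1) 2 = 0 := by
      rw [← hcoord]; exact hE1 s z _ (by simp)
    have hD12 : fderiv ℝ (U (-1)) (Γ s + z • e2) (EuclideanSpace.single 1 1) 2 = 0 := by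
      rw [← hcoord]; exact hE1 s z _ (by simp)
    have hD20 := hE3 s z hz 0 (by decide)
    have hD21 := hE3 s z hz 1 (by decide)
    have hc2 : curl (U (-1)) (Γ s + z • e2) 2 = 0 := by
      simpa [EuclideanSpace.inner_single_right] using hpol (-1) hm1 (Γ s + z • e2)
    have hc2' : fderiv ℝ (U (-1)) (Γ s + z • e2) (EuclideanSpace.single 0 1) 1 - fderiv ℝ (U (-1)) (Γ s + z • e2) (EuclideanSpace.single 1 1) 0 = 0 := by
      simpa [curl] using hc2
    ext i
    fin_cases i <;> simp [curl, hD02, hD12, hD20, hD21, hc2']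
  /- (E4): the identities at the centre, and the vertical Huygens identity -/
  have hE4 : ∀ s z : ℝ, |z| < δ₁ →
      fderiv ℝ (fderiv ℝ (fun y => σ * U (-1) y 2)) (Γ s + z • e2) (deriv Γ s) (deriv Γ s) +
          fderiv ℝ (fderiv ℝ (fun y => σ * U (-1) y 2)) (Γ s + z • e2) (rotJ (deriv Γ s)) (rotJ (deriv Γ s)) = -κt 0 z ∧
      σ * (fderiv ℝ (fun w => fderiv ℝ (fun y => U (-1) y 2) w (EuclideanSpace.single 0 (1 : ℝ))) (Γ s + z • e2) (EuclideanSpace.single 0 (1 : ℝ)) +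
          fderiv ℝ (fun w => fderiv ℝ (fun y => U (-1) y 2) w (EuclideanSpace.single 1 (1 : ℝ))) (Γ s + z • e2) (EuclideanSpace.single 1 (1 : ℝ))) =
        -κt 0 z ∧
      fderiv ℝ (fderiv ℝ (fun y => σ * U (-1) y 2)) (Γ s + z • e2) e2 e2 = μ (-1) z * κt 0 z := by
    intro s z hz
    have h8 := (hP s z hz).2.2.2.2.1
    have h9 := (hP s z hz).2.2.2.2.2.1
    rw [hE0 s z hz, zero_smul, add_zero] at h8 h9
    refine ⟨h8, ?_, ?_⟩
    · -- frame trace = coordinate horizontal Laplacian (`frame_trace_at` with `τ = 0`)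
      have hft := frame_trace_at (σ := σ) hrate hcont hmild hdiv (hT2 s) (hTunit s) (τ := 0) (by norm_num) (Γ s + z • e2)
      simp only [add_zero] at hft
      have hJ : Jvec (deriv Γ s) = rotJ (deriv Γ s) := rfl
      rw [hJ] at hft
      rw [← hft]; exact h8
    · rw [h9, h8]; ring
  have hRzz : ∀ z : ℝ, |z| < δ₁ → deriv (deriv (R 0)) z = μ (-1) z * κt 0 z := by
    intro z hz
    have h10 := (hP 0 z hz).2.2.2.2.2.2
    have hn0 : n₀ ((0 : ℝ), (0 : ℝ), z) = 0 := hE0 0 z hz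
    -- the `z`- and `s`-partials of `n₀` vanish at `(0, 0, z)`: `n₀ (0, ·, ·) ≡ 0` near it
    have hdiffn : DifferentiableAt ℝ n₀ ((0 : ℝ), (0 : ℝ), z) := ((hP 0 z hz).2.2.2.1 1).differentiableAt (by simp)
    have hGz : fderiv ℝ n₀ ((0 : ℝ), (0 : ℝ), z) ((0 : ℝ), (0 : ℝ), (1 : ℝ)) = 0 := by
      have hl : HasDerivAt (fun z' : ℝ => (((0 : ℝ), (0 : ℝ), z') : ℝ × ℝ × ℝ)) ((0 : ℝ), (0 : ℝ), (1 : ℝ)) z := by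
        have h1 := (hasDerivAt_const z (0 : ℝ)).prodMk (hasDerivAt_id z)
        simpa using (hasDerivAt_const z (0 : ℝ)).prodMk h1
      have hc := hdiffn.hasFDerivAt.comp_hasDerivAt z hl
      have hev : (fun z' : ℝ => n₀ ((0 : ℝ), (0 : ℝ), z')) =ᶠ[𝓝 z] fun _ => 0 := by
        have hmem : Ioo (-δ₁) δ₁ ∈ 𝓝 z := isOpen_Ioo.mem_nhds ⟨by linarith [(abs_lt.1 hz).1], (abs_lt.1 hz).2⟩
        filter_upwards [hmem] with z' hz'
        exact hE0 0 z' (abs_lt.2 ⟨hz'.1, hz'.2⟩)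
      have h1 : deriv (fun z' : ℝ => n₀ ((0 : ℝ), (0 : ℝ), z')) z = fderiv ℝ n₀ ((0 : ℝ), (0 : ℝ), z) ((0 : ℝ), (0 : ℝ), (1 : ℝ)) := hc.deriv
      rw [hev.deriv_eq, deriv_const] at h1; exact h1.symm
    have hGs : fderiv ℝ n₀ ((0 : ℝ), (0 : ℝ), z) ((0 : ℝ), (1 : ℝ), (0 : ℝ)) = 0 := by
      have hl : HasDerivAt (fun s' : ℝ => (((0 : ℝ), s', z) : ℝ × ℝ × ℝ)) ((0 : ℝ), (1 : ℝ), (0 : ℝ)) 0 := by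
        have h1 := (hasDerivAt_id (0 : ℝ)).prodMk (hasDerivAt_const (0 : ℝ) z)
        simpa using (hasDerivAt_const (0 : ℝ) (0 : ℝ)).prodMk h1
      have hc := hdiffn.hasFDerivAt.comp_hasDerivAt 0 hl
      have hev : (fun s' : ℝ => n₀ ((0 : ℝ), s', z)) =ᶠ[𝓝 0] fun _ => 0 := Filter.Eventually.of_forall fun s' => hE0 s' z hz
      have h1 : deriv (fun s' : ℝ => n₀ ((0 : ℝ), s', z)) 0 = fderiv ℝ n₀ ((0 : ℝ), (0 : ℝ), z) ((0 : ℝ), (1 : ℝ), (0 : ℝ)) := hc.deriv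
      rw [hev.deriv_eq, deriv_const] at h1; exact h1.symm
    rw [hn0, hGz, hGs] at h10
    have h : (deriv (deriv (R 0)) z - μ (-1) z * κt 0 z) * 1 = 0 := by linear_combination -h10
    linarith
  exact ⟨δ₁, hδ₁pos, min_le_right _ _, hE0, hE1, hE2, hE3, hcurl, hE4, hRzz⟩

end Summit.NavierStokesRegularity.NavierStokesRegularity.Theorems.PoloidalWindowDoorLrcModEntireQ4CurvedVerticalEntrance

end
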